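import Literature.MathematicalPhysics.QuantumFieldTheory.OSTemperedness
import Literature.MathematicalPhysics.QuantumFieldTheory.OSPointVectorContinuity
import HarnessLib

/-!
# Continuous local densities of a Schwinger family: translation invariance and transport

Topic `Literature/MathematicalPhysics/QuantumFieldTheory`; support file (all proved; the local
density predicate as a definition; no named facts) for the discharge of (A1)
`OS1975_exists_timeContinuation`. Osterwalder–Schrader II (Comm. Math. Phys. 42 (1975)), §IV.2
Thm. 4.1: the Schwinger distributions restricted to the configurations with increasing times are
given by continuous (indeed real-analytic) functions `S_N`. Two elementary consequences used by the
pointwise Gram identity (5.2)/(5.4): a continuous local density of a translation invariant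
distribution is translation invariant (uniqueness of continuous densities,
`OSPointwiseAnalyticity.eqOn_of_forall_integral_mul_eq`), and densities transport along an
equality of the number of points.

* `IsLocalDensity 𝔖 N S` — `S` is continuous on the configurations with increasing times and
  represents `𝔖 N` on the test functions supported in small balls there;
* `IsLocalDensity.add_timeVec` — `S (y + t e₀) = S y`;
* `IsLocalDensity.transport` — transport along `N = N'`;
* `exists_isLocalDensity_tempered` — Thm. 4.1 with (4.5) in this packaging.

## References

* K. Osterwalder, R. Schrader, *Axioms for Euclidean Green's functions II*, Comm. Math. Phys.
  42 (1975) 281–305, §IV.2 Thm. 4.1, (4.4)–(4.5); Ch. V (5.2). [OsterwalderSchraderCMP1975]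
-/

noncomputable section

open MeasureTheory Set Filter Metric
open _root_.Topology
open scoped SchwartzMap

namespace Literature.MathematicalPhysics.QuantumFieldTheory

variable {d : ℕ} [NeZero d]

open Literature.MathematicalPhysics.QuantumLattice (SchwingerFamily translateMulti translateMulti_apply)
open Literature.MathematicalPhysics.QuantumLattice.SchwingerFamily

/-! ### Local densities -/

section LocalDensity

variable {N : ℕ}

/-- The open set of configurations with strictly increasing times. [folklore] -/
def incrTimes (N d : ℕ) [NeZero d] : Set (Fin N → EuclideanSpace ℝ (Fin d)) := {y | StrictMono fun j => y j 0}

/-- Membership in `incrTimes`. [folklore] -/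
theorem mem_incrTimes {y : Fin N → EuclideanSpace ℝ (Fin d)} : y ∈ incrTimes N d ↔ StrictMono fun j => y j 0 := Iff.rfl

/-- `incrTimes` is open. [folklore] -/
theorem isOpen_incrTimes : IsOpen (incrTimes N d) := by
  have hc : ∀ i : Fin N, Continuous fun y : Fin N → EuclideanSpace ℝ (Fin d) => y i 0 := fun i =>
    (EuclideanSpace.proj (0 : Fin d)).continuous.comp (continuous_apply i)
  have h : incrTimes N d = ⋂ i : Fin N, ⋂ j : Fin N, {y | i < j → y i 0 < y j 0} := by
    ext y
    simp only [mem_incrTimes, mem_iInter, mem_setOf_eq]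
    exact ⟨fun h i j hij => h hij, fun h i j hij => h i j hij⟩
  rw [h]
  refine isOpen_iInter_of_finite fun i => isOpen_iInter_of_finite fun j => ?_
  by_cases hij : i < j
  · have hset : {y : Fin N → EuclideanSpace ℝ (Fin d) | i < j → y i 0 < y j 0} = {y | y i 0 < y j 0} := by
      ext y; simp [hij]
    rw [hset]
    exact isOpen_lt (hc i) (hc j)
  · have hset : {y : Fin N → EuclideanSpace ℝ (Fin d) | i < j → y i 0 < y j 0} = univ := by
      ext y; simp [hij]
    rw [hset]
    exact isOpen_univ

/-- **Continuous local densities** of `𝔖 N` on the configurations with increasing times. [cite: OsterwalderSchraderCMP1975, §IV.2 Thm. 4.1 (4.4)] -/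
structure IsLocalDensity (𝔖 : SchwingerFamily (EuclideanSpace ℝ (Fin d))) (N : ℕ)
    (S : (Fin N → EuclideanSpace ℝ (Fin d)) → ℂ) : Prop where
  cont : ContinuousOn S (incrTimes N d)
  rep : ∀ y ∈ incrTimes N d, ∃ ρ : ℝ, 0 < ρ ∧ ball y ρ ⊆ incrTimes N d ∧
    ∀ F : 𝓢((Fin N → EuclideanSpace ℝ (Fin d)), ℂ), tsupport (F : (Fin N → EuclideanSpace ℝ (Fin d)) → ℂ) ⊆ ball y ρ →
      𝔖 N F = ∫ z, S z * F z

variable {𝔖 : SchwingerFamily (EuclideanSpace ℝ (Fin d))} {S : (Fin N → EuclideanSpace ℝ (Fin d)) → ℂ}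

omit [NeZero d] in
/-- The support of a translate. [folklore] -/
theorem tsupport_comp_sub_subset (F : (Fin N → EuclideanSpace ℝ (Fin d)) → ℂ) (A : Fin N → EuclideanSpace ℝ (Fin d)) :
    tsupport (fun w => F (w - A)) ⊆ (fun z => z + A) '' tsupport F := by
  intro w hw
  refine ⟨w - A, ?_, sub_add_cancel w A⟩
  have hcont : Continuous fun w : Fin N → EuclideanSpace ℝ (Fin d) => w - A := continuous_id.sub continuous_const
  have h1 : (fun w => w - A) '' Function.support (fun w => F (w - A)) ⊆ Function.support F := by
    rintro _ ⟨w, hw, rfl⟩; exact hw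
  have h2 := image_closure_subset_closure_image hcont (s := Function.support fun w => F (w - A)) ⟨w, hw, rfl⟩
  exact closure_mono h1 h2

/-- Time translation preserves increasing times. [folklore] -/
theorem add_timeVec_mem_incrTimes {y : Fin N → EuclideanSpace ℝ (Fin d)} (hy : y ∈ incrTimes N d) (t : ℝ) :
    (fun j => y j + timeVec t) ∈ incrTimes N d := by
  rw [mem_incrTimes] at hy ⊢
  intro i j hij
  have h := hy hij
  have ht0 : (timeVec t : EuclideanSpace ℝ (Fin d)) 0 = t := by simp [timeVec]
  simp only [PiLp.add_apply, ht0] at h ⊢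
  linarith

/-- **A continuous local density of a translation invariant distribution is time-translation
invariant**: `S (y + t e₀) = S y` on the configurations with increasing times. [cite: OsterwalderSchraderCMP1975, §IV.2 Thm. 4.1] -/
theorem IsLocalDensity.add_timeVec (hS : IsLocalDensity 𝔖 N S) (hE1 : 𝔖.IsEuclideanCovariant) (t : ℝ)
    {y : Fin N → EuclideanSpace ℝ (Fin d)} (hy : y ∈ incrTimes N d) :
    S (fun j => y j + timeVec t) = S y := by
  set A : Fin N → EuclideanSpace ℝ (Fin d) := fun _ => timeVec t with hA
  have hyA : ∀ z : Fin N → EuclideanSpace ℝ (Fin d), (fun j => z j + timeVec t) = z + A := fun z => rfl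
  -- the translated density
  set g : (Fin N → EuclideanSpace ℝ (Fin d)) → ℂ := fun z => S (z + A) with hg
  have hmaps : MapsTo (fun z : Fin N → EuclideanSpace ℝ (Fin d) => z + A) (incrTimes N d) (incrTimes N d) :=
    fun z hz => by show z + A ∈ incrTimes N d; rw [← hyA]; exact add_timeVec_mem_incrTimes hz t
  have hgc : ContinuousOn g (incrTimes N d) := hS.cont.comp (continuous_id.add continuous_const).continuousOn hmaps
  -- the two representation balls
  obtain ⟨ρ₁, hρ₁, hb₁, hrep₁⟩ := hS.rep y hy
  obtain ⟨ρ₂, hρ₂, hb₂, hrep₂⟩ := hS.rep (y + A) (hmaps hy)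
  set V : Set (Fin N → EuclideanSpace ℝ (Fin d)) := ball y (min ρ₁ ρ₂) with hV
  have hVopen : IsOpen V := isOpen_ball
  have hyV : y ∈ V := mem_ball_self (lt_min hρ₁ hρ₂)
  have hV₁ : V ⊆ ball y ρ₁ := ball_subset_ball (min_le_left _ _)
  have hV₂ : V ⊆ ball y ρ₂ := ball_subset_ball (min_le_right _ _)
  have hVU : V ⊆ incrTimes N d := hV₁.trans hb₁
  have heq := eqOn_of_forall_integral_mul_eq hVopen (hS.cont.mono hVU) (hgc.mono hVU) fun F hF _ => by
    -- `∫ S F = 𝔖 F = 𝔖 (F translated) = ∫ S (F translated) = ∫ g F`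
    rw [← hrep₁ F (hF.trans hV₁)]
    have hsupp : tsupport ((translateMulti (timeVec t) F : 𝓢((Fin N → EuclideanSpace ℝ (Fin d)), ℂ)) :
        (Fin N → EuclideanSpace ℝ (Fin d)) → ℂ) ⊆ ball (y + A) ρ₂ := by
      have h1 : ((translateMulti (timeVec t) F : 𝓢((Fin N → EuclideanSpace ℝ (Fin d)), ℂ)) :
          (Fin N → EuclideanSpace ℝ (Fin d)) → ℂ) = fun w => F (w - A) := by
        funext w; rw [translateMulti_apply]; rfl
      rw [h1]
      refine (tsupport_comp_sub_subset F A).trans ?_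
      rintro _ ⟨z, hz, rfl⟩
      have hz' : z ∈ ball y ρ₂ := hV₂ (hF hz)
      rw [mem_ball] at hz' ⊢
      simpa [dist_eq_norm] using hz'
    rw [← hE1.translateMulti N (timeVec t) F, hrep₂ _ hsupp]
    have h2 : (fun w => S w * (translateMulti (timeVec t) F : 𝓢((Fin N → EuclideanSpace ℝ (Fin d)), ℂ)) w) =
        fun w => (fun z => g z * F z) (w - A) := by
      funext w
      simp only [hg, translateMulti_apply, sub_add_cancel]
      rfl
    rw [h2]
    exact (integral_sub_right_eq_self (fun z => g z * F z) A)
  have h := heq hyV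
  rw [hg] at h
  simp only at h
  rw [hyA, h]

/-- **Transport of local densities along an equality of the number of points.** [folklore] -/
theorem IsLocalDensity.transport {N N' : ℕ} (h : N = N') {S' : (Fin N' → EuclideanSpace ℝ (Fin d)) → ℂ}
    (hS' : IsLocalDensity 𝔖 N' S') : IsLocalDensity 𝔖 N fun y => S' fun i => y (Fin.cast h.symm i) := by
  subst h
  exact hS'

/-- A local density in the packaging of `OSPointVectors.inner_pointVector`. [folklore] -/
theorem IsLocalDensity.rep' (hS : IsLocalDensity 𝔖 N S) :
    ∀ y : Fin N → EuclideanSpace ℝ (Fin d), StrictMono (fun j => y j 0) → ∃ ρ : ℝ, 0 < ρ ∧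
      ball y ρ ⊆ {y | StrictMono fun j => y j 0} ∧
      ∀ F : 𝓢((Fin N → EuclideanSpace ℝ (Fin d)), ℂ), tsupport (F : (Fin N → EuclideanSpace ℝ (Fin d)) → ℂ) ⊆ ball y ρ →
        𝔖 N F = ∫ z, S z * F z :=
  fun y hy => hS.rep y hy

end LocalDensity

/-! ### Theorem 4.1 with (4.5) as a local density -/

section Tempered

variable {k : ℕ}

/-- `orderedRegion` is `incrTimes`. [folklore] -/
theorem orderedRegion_eq_incrTimes : orderedRegion k d = incrTimes (k + 2) d :=
  Set.ext fun x => (strictMono_time_iff x).symm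

/-- **Theorem 4.1 with the temperedness estimate (4.5)**: a continuous local density of `𝔖 (k+2)`
with `‖S x‖ ≤ C (1 + ‖x‖)ᴺ (1 + (minGap x)⁻¹)ᴺ`. [cite: OsterwalderSchraderCMP1975, §IV.2 Thm. 4.1 (4.4)–(4.5)] -/
theorem exists_isLocalDensity_tempered (𝔖 : SchwingerFamily (EuclideanSpace ℝ (Fin d)))
    (hE1 : 𝔖.IsEuclideanCovariant) (hE2 : 𝔖.IsOSReflectionPositive) (hE0 : 𝔖.HasLinearGrowth) :
    ∃ S : (Fin (k + 2) → EuclideanSpace ℝ (Fin d)) → ℂ, IsLocalDensity 𝔖 (k + 2) S ∧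
      ∃ C : ℝ, ∃ N : ℕ, 0 ≤ C ∧ ∀ x ∈ incrTimes (k + 2) d, ‖S x‖ ≤ C * (1 + ‖x‖) ^ N * (1 + (minGap x)⁻¹) ^ N := by
  obtain ⟨S, hSc, hloc, C, N, hC, hb⟩ := schwinger_exists_realAnalytic_density_tempered (k := k) 𝔖 hE1 hE2 hE0
  rw [orderedRegion_eq_incrTimes] at hSc hloc hb
  refine ⟨S, ⟨hSc, fun y hy => ?_⟩, C, N, hC, hb⟩
  obtain ⟨ρ, hρ, hball, -, -, -, hrep⟩ := hloc y hy
  exact ⟨ρ, hρ, hball, hrep⟩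

end Tempered

end Literature.MathematicalPhysics.QuantumFieldTheory
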